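import Summits.BirchSwinnertonDyer.BirchSwinnertonDyer.Theorems.EisensteinPrimesBSDpOnCellCAcDescentControlCoker
import Summits.BirchSwinnertonDyer.BirchSwinnertonDyer.Theorems.EisensteinPrimesBSDpOnCellCAcDescentFixedPointsFinite
import HarnessLib

/-!
# Crux 4 `BSDpOnCellC` (stmt-BirchSwinnertonDyer-19034), line «crystal» v10: the registered stub `stub_acDescent` from ONE arithmetic input —
# (FE) «`X_Gr(E_K/K̃_∞)[T₁]` has finite exponent» (cell `bsd-eis`, width seat `bsd-line-x2-p2` gen 14; `--supports stmt-BirchSwinnertonDyer-19034`;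
# skeleton of record UNCHANGED, W-79)

This seat's chain for `stub_acDescent` (Lines/crystal.lean v10, l. 368: `(∀ W p, CellC W p → TwoVarRatDivPNew W p) →` both signs of road R-β,
`X2.{Nonsplit,Split}KolyvaginDivOnTreeIntOther`):
* p699999 `…AcDescentTowerGlue` — the cyclotomic partner pair of an anticyclotomic generator; `X_ac`, its characteristic ideal and the BDP frame do not
  see the lift `γ ↦ γδ`;
* p700489 `…AcDescentCokerAlgebra` — rational specialisation `T₁ ↦ 0` through a control map with finite-exponent cokernel (Herbrand formula of bsd-wall's
  `PowerSeriesSpecialization.charIdeal_quotSMulTop_eq_mul`);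
* p701201 `…AcDescentOfInputs` — `acDescent_of_inputs : (FE) → (Ctrl) → stub`;
* p702662 `…AcDescentControlCoker` — `(Ctrl) ⟸ (TPfe)` (inflation–restriction in torsion form), `acDescent_of_inputs_fe : (FE) → (TPfe) → stub`;
* p703372 `…AcDescentFixedPointsFinite` — **(TPfe) PROVED**: `E_K[p^∞]^{Gal(K̄/K̃_∞)}` has finite exponent for every `E/ℚ`, odd `p`, imaginary quadratic
  `K` with `d_K < −4`, `κ₁` cyclotomic, `κ` anticyclotomic (no `Γ_ℚ`-stable `p`-divisible line + Weil pairing + `μ(K) = ±1`).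

THIS FILE: **`AcDescent.acDescent_of_finiteExponent : (FE) → <stub_acDescent VERBATIM>`** — the registered stub now rests on EXACTLY ONE displayed
input, (FE): for every minimal elliptic `W` on cell C at `p`, number field `K`, cyclotomic `κ₁`, anticyclotomic `κ`, `𝔭̄ ∣ p` and generator pair
`(γ₁, γ)`, `∃ m, p^m · X_Gr(E_K/K̃_∞)(𝔭̄)[T₁] = 0` — the LEAD's named risk of the v7–v10 docstring («a nonzero pseudo-null `Λ₂`-submodule of `X_Gr`
with `T₁`-torsion of positive `Λ`-rank»; Greenberg 2016 Prop. 4.1.1 is the printed no-pseudo-null theorem at GOOD `p` under (SUR)/(LEO); nothing is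
in print at a residually reducible `p ‖ N`). Also the pointwise form `kolyvaginDivIntOther_of_twoVarRatDivPNew_of_finiteExponent` (one datum, (FE) for
that datum only). All other ingredients of the v10 docstring's proof sketch — `X_Gr/T₁ → X_ac` control «no local term at `𝔭`, strict term at `𝔭̄` finite,
`v ∤ p` terms finite, global kernel `p`-power via the isogenous `E′`», isogeny invariance, ideal arithmetic in `𝓞_{ℂ_p}⟦T⟧` — turned out to be
UNNECESSARY for the Kolyvagin direction: only the SURJECTIVITY-up-to-finite-exponent of `X_Gr₂/T₁ → X_ac` enters, and it follows from
`E(K̃_∞)[p^∞]` finite, proved here for every curve on cell C (no isogenous `E′` needed).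

HONEST FRAMING: CONDITIONAL on (FE); `stub_acDescent` is NOT closed and the skeleton of record is untouched (W-79); nothing about any curve's Selmer
group is asserted; no summit statement / BSD / MC / IMC is proved for any curve; 0 cells / labels / tiers move.

References: [Greenberg2016Selmer] Prop. 4.1.1; [Ochiai2006] Def. 7.1, Lemma 7.2 (Compositio Math. 142 pp. 1187–1188); [SkinnerUrban2014] §3.2.7–3.2.8,
Cor. 3.2.9 (ii); [BurungaleCastellaSkinner2025] §2.1, Conj. 4.1.2, Thm. 4.1.3 (arXiv:2405.00270v2 pp. 6, 8); [GreenbergLNM1716] §1 p. 62, §3 Lemma 3.1;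
tree: this seat's five files above, `Lines/crystal.lean` v10, `…AccumDefs` (`TwoVarRatDivPNew`).
-/

set_option autoImplicit false
set_option linter.dupNamespace false

noncomputable section

open scoped Classical

namespace Summit.BirchSwinnertonDyer.BirchSwinnertonDyer.Theorems.AcDescent

open scoped MatrixGroups ModularForm

open CongruenceSubgroup WeierstrassCurve NumberField IsDedekindDomain Field PowerSeries
  Literature.NumberTheory.EllipticCurves Literature.NumberTheory.EllipticCurves.GreenbergSelmer
  Literature.NumberTheory.EllipticCurves.ModularForms Literature.NumberTheory.QuadraticFields
  Literature.NumberTheory.EllipticCurves.Rank1Residual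
  Literature.NumberTheory.EllipticCurves.Rank1Residual.Typed
  Literature.NumberTheory.GaloisRepresentations Literature.NumberTheory.GaloisCohomology
  Literature.NumberTheory.Automorphic
  Summit.BirchSwinnertonDyer.Rank1Residual.X11b.AcSelmer
  Summit.BirchSwinnertonDyer.Rank1Residual.X11b.Halves
  Summit.BirchSwinnertonDyer.Rank1Residual.X11b
  Summit.BirchSwinnertonDyer.Rank1Residual Summit.BirchSwinnertonDyer.Rank1Residual.X1
  Summit.BirchSwinnertonDyer.Rank1Residual.X2
open Summit.BirchSwinnertonDyer.BirchSwinnertonDyer.Theorems.EisensteinPrimesBSDpOnCellCAccumDefs (TwoVarRatDivPNew)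

/-- **X2's R-β conclusion at ONE datum from `TwoVarRatDivPNew W p` and (FE) alone** — `kolyvaginDivIntOther_of_twoVarRatDivPNew_of_control` with its
control input supplied by `control_of_fixedExponent` ∘ `WeierstrassCurve.exists_pow_smul_eq_zero_of_fixed_pairKer` (`p ≠ 2` from `CellC`, `K` imaginary
quadratic with `d_K < −4` from the binders). [cite: GreenbergLNM1716, §3 Lemma 3.1] [cite: Ochiai2006, Lemma 7.2 (Compositio Math. 142 pp. 1187–1188)] -/
theorem kolyvaginDivIntOther_of_twoVarRatDivPNew_of_finiteExponent
    (W : WeierstrassCurve ℚ) [W.IsElliptic] [W.IsGloballyMinimal] (p : ℕ) [Fact p.Prime]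
    (hTwo : TwoVarRatDivPNew W p)
    (N : ℕ) [NeZero N] (K : Type) [Field K] [NumberField K] (Dt : ModularParametrizationData W N)
    (H : HeegnerDatum N (NumberField.discr K)) (ιK : K →+* ℂ) (P : (W.baseChange K).toAffine.Point)
    (hC : CellC W p) (hN : W.conductorNorm ℤ = N)
    (hK : IsImaginaryQuadratic K) (hD : NumberField.discr K < -4) (hHeeg : SatisfiesHeegnerHypothesis N K)
    (hL1 : (W.quadraticTwist (NumberField.discr K : ℚ)).entireLFunction 1 ≠ 0)
    (hP : WeierstrassCurve.Affine.Point.map ιK.toRatAlgHom P = heegnerPointComplex Dt H)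
    (hc : ¬ (p : ℤ) ∣ Dt.c) (hPt : ¬ IsOfFinAddOrder P) (hodd : Odd (NumberField.discr K))
    (κ : ZpExtension K p) (hκ : κ.IsAnticyclotomic)
    (γ : Field.absoluteGaloisGroup K) [Fact (κ.IsTopGenerator γ)]
    (𝔭 : HeightOneSpectrum (𝓞 K)) (h𝔭 : ((p : ℕ) : 𝓞 K) ∈ 𝔭.asIdeal)
    (he : 𝔭.asIdeal.ramificationIdx (𝓞 ℚ) = 1) (hdeg : 𝔭.asIdeal.inertiaDeg (𝓞 ℚ) = 1)
    (𝔭bar : HeightOneSpectrum (𝓞 K)) (h𝔭bar : ((p : ℕ) : 𝓞 K) ∈ 𝔭bar.asIdeal) (hne : 𝔭bar ≠ 𝔭)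
    (hsplit : ((Ideal.span {(p : ℤ)}).primesOver (𝓞 K)).ncard = 2)
    (f : CuspForm (CongruenceSubgroup.Gamma0 N) 2) (hf : IsNewformOf W f)
    (ι' : PadicAlgCl p ≃+* ℂ)
    (hι' : ∀ (w : InfinitePlace K) (k : 𝓞 K), k ∈ 𝔭.asIdeal ↔ ‖ι'.symm (w.embedding (k : K))‖ < 1)
    (ΩK : ℂ) (Ωp : ℂ_[p]) (Q : PowerSeries 𝓞_ℂ_[p]) (hΩK : ΩK ≠ 0) (hΩp : ‖Ωp‖ = 1)
    (hQ : R1.IsBDPLFunctionInt p ι' 𝔭 κ γ f ΩK Ωp Q)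
    (hFE : ∀ (κ₁ : ZpExtension K p), κ₁.IsCyclotomic →
      ∀ (γ₁ γ' : Field.absoluteGaloisGroup K) [Fact (ZpExtension.IsTopGeneratorPair κ₁ κ γ₁ γ')],
      ∃ m : ℕ, ∀ x : (W.baseChange K).XGr₂ p κ₁ κ 𝔭bar γ₁ γ',
        (PowerSeries.X : IwasawaAlgebra₂ p) • x = 0 → ((p : IwasawaAlgebra₂ p) ^ m) • x = 0) :
    ∃ k : ℕ, PowerSeries.C ((p : 𝓞_ℂ_[p]) ^ k) * Q ∈
      (XAc.charIdeal (W.baseChange K) p κ 𝔭bar ∅ γ).map (PowerSeries.map (R1.toCpInt p)) :=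
  kolyvaginDivIntOther_of_twoVarRatDivPNew_of_control W p hTwo N K Dt H ιK P hC hN hK hD hHeeg hL1 hP hc hPt hodd κ hκ γ 𝔭 h𝔭
    he hdeg 𝔭bar h𝔭bar hne hsplit f hf ι' hι' ΩK Ωp Q hΩK hΩp hQ hFE
    fun κ₁ hκ₁ γ₁ γ' hpair _ ↦ by
      obtain ⟨a, ha⟩ := (W.exists_pow_smul_eq_zero_of_fixed_pairKer hC.2.1 hK hD hκ₁ hκ hpair.out :
        ∃ a : ℕ, ∀ m : geomPrimaryTorsion (W.baseChange K) p,
          (∀ σ ∈ ZpExtension.pairKer κ₁ κ, σ • m = m) → p ^ a • m = 0)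
      exact control_of_fixedExponent (W.baseChange K) p κ₁ κ 𝔭bar γ₁ γ' ha

/-- **`stub_acDescent` (crystal v10, VERBATIM) ⟸ (FE).** The registered stub from the ONE input (FE): for every minimal elliptic `W` on cell C at `p`,
every number field `K`, cyclotomic `κ₁`, anticyclotomic `κ`, `𝔭̄ ∣ p` and generator pair `(γ₁, γ)`: `∃ m, p^m · X_Gr(E_K/K̃_∞)(𝔭̄)[T₁] = 0` (the LEAD's
named risk; Greenberg 2016 Prop. 4.1.1 genre). Everything else of the v7–v10 proof sketch is DERIVED in the tree (this seat's p699999–p703372 + bsd-wall's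
Herbrand specialisation + `TwoVariableAnticyclotomicControl` + `XAc.module_finite_empty`). CONDITIONAL; nothing asserted.
[cite: Greenberg2016Selmer, Prop. 4.1.1] [cite: Ochiai2006, Def. 7.1 and Lemma 7.2 (Compositio Math. 142 pp. 1187–1188)]
[cite: BurungaleCastellaSkinner2025, §2.1 and Thm. 4.1.3 (arXiv:2405.00270v2 pp. 6, 8)] [cite: GreenbergLNM1716, §1 p. 62 and §3 Lemma 3.1] -/
theorem acDescent_of_finiteExponent
    (hFE : ∀ (W : WeierstrassCurve ℚ) [W.IsElliptic] [W.IsGloballyMinimal] (p : ℕ) [Fact p.Prime], CellC W p →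
      ∀ (K : Type) [Field K] [NumberField K] (κ₁ κ : ZpExtension K p), κ₁.IsCyclotomic → κ.IsAnticyclotomic →
      ∀ (𝔭bar : HeightOneSpectrum (𝓞 K)), ((p : ℕ) : 𝓞 K) ∈ 𝔭bar.asIdeal →
      ∀ (γ₁ γ : Field.absoluteGaloisGroup K) [Fact (ZpExtension.IsTopGeneratorPair κ₁ κ γ₁ γ)],
      ∃ m : ℕ, ∀ x : (W.baseChange K).XGr₂ p κ₁ κ 𝔭bar γ₁ γ,
        (PowerSeries.X : IwasawaAlgebra₂ p) • x = 0 → ((p : IwasawaAlgebra₂ p) ^ m) • x = 0) :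
    (∀ (W : WeierstrassCurve ℚ) [W.IsElliptic] [W.IsGloballyMinimal] (p : ℕ) [Fact p.Prime],
      CellC W p → TwoVarRatDivPNew W p) →
    (∀ (W : WeierstrassCurve ℚ) [W.IsElliptic] [W.IsGloballyMinimal] (p : ℕ) [Fact p.Prime],
      CellC W p → ¬ W.HasSplitMultiplicativeReductionAtPrime p → NonsplitKolyvaginDivOnTreeIntOther W p) ∧
    (∀ (W : WeierstrassCurve ℚ) [W.IsElliptic] [W.IsGloballyMinimal] (p : ℕ) [Fact p.Prime],
      CellC W p → W.HasSplitMultiplicativeReductionAtPrime p → SplitKolyvaginDivOnTreeIntOther W p) := by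
  intro hTwo
  refine ⟨fun W _ _ p _ hC _ => ?_, fun W _ _ p _ hC _ => ?_⟩
  · intro N _ K _ _ Dt H ιK P hC' _ hN hK hD hHeeg hL1 hP hc hPt hodd κ hκ γ _ 𝔭 h𝔭 he hdeg 𝔭bar h𝔭bar hne hsplit
      f hf ι' hι' ΩK Ωp Q hΩK hΩp hQ
    exact kolyvaginDivIntOther_of_twoVarRatDivPNew_of_finiteExponent W p (hTwo W p hC) N K Dt H ιK P hC' hN hK hD hHeeg hL1 hP
      hc hPt hodd κ hκ γ 𝔭 h𝔭 he hdeg 𝔭bar h𝔭bar hne hsplit f hf ι' hι' ΩK Ωp Q hΩK hΩp hQ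
      (fun κ₁ hκ₁ γ₁ γ' _ => hFE W p hC K κ₁ κ hκ₁ hκ 𝔭bar h𝔭bar γ₁ γ')
  · intro N _ K _ _ Dt H ιK P hC' _ hN hK hD hHeeg hL1 hP hc hPt hodd κ hκ γ _ 𝔭 h𝔭 he hdeg 𝔭bar h𝔭bar hne hsplit
      f hf ι' hι' ΩK Ωp Q hΩK hΩp hQ
    exact kolyvaginDivIntOther_of_twoVarRatDivPNew_of_finiteExponent W p (hTwo W p hC) N K Dt H ιK P hC' hN hK hD hHeeg hL1 hP
      hc hPt hodd κ hκ γ 𝔭 h𝔭 he hdeg 𝔭bar h𝔭bar hne hsplit f hf ι' hι' ΩK Ωp Q hΩK hΩp hQ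
      (fun κ₁ hκ₁ γ₁ γ' _ => hFE W p hC K κ₁ κ hκ₁ hκ 𝔭bar h𝔭bar γ₁ γ')

end Summit.BirchSwinnertonDyer.BirchSwinnertonDyer.Theorems.AcDescent

end
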